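import Summits.Ventures.LatticeQCDFlow.Exactness.Phi4HMCFluctuationRelation
import Literature.Probability.Distributions.PseudoMarginalGaussianNoise
import HarnessLib

/-!
# The `erfc` law in the involution vocabulary: if the equilibrium law of `ΔH` is `N(m, v)` then
# Creutz forces `v = 2m` and `⟨P_acc⟩ = 2Φ(−√(m/2)) = erfc(½√m)`, inside `[1 − √(m/π), e^{−m/4}]`

HONEST FRAMING: exact (Metropolis-corrected) sampling algorithms for lattice gauge theory;
figures of merit are autocorrelation/cost numbers at stated couplings and volumes; no
continuum-physics claim.  (SCALAR calibration rung S0-A: not a gauge result.)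

Venture `LatticeQCDFlow` (cell pub-lqcd), topic `Exactness`; FANOUT row 2 (`s0-phi4`, HMC arm: the
`dH` / acceptance columns).  NEW WORK of the cell — a BRIDGE file — over row 2's
`Phi4HMCFluctuationRelation` (`(X, μ)`, `Ψ` a measurable `μ`-preserving involution, weight `e^{−H}`,
`ΔH = deltaH H Ψ = H∘Ψ − H`, Creutz `∫ e^{−ΔH} e^{−H} = ∫ e^{−H}`), the tree's Literature files
`Probability/Distributions/GaussianMetropolisAcceptance` (Knechtli–Wolff 2003 §3: `⟨e^{−Δ}⟩ = 1` and
`⟨min(1,e^{−Δ})⟩ = 2P(Δ ≤ 0) = erfc(√(w/8))` FOR the law `N(w/2, w)`) and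
`…/PseudoMarginalGaussianNoise` (`gaussianReal_Iic_eq_std`), and Mathlib's `gaussianReal`.  Nothing is
cited as a fact here; no definition.  Printed counterparts NAMED ONLY: Gupta–Irbäck–Karsch–Petersson
1990, Kennedy–Pendleton 1991 (`⟨P_acc⟩ = erfc(½√⟨ΔH⟩)`), Creutz 1988.  Siblings in the tree for the
other arms: `Scaling/GaussianWeights` (`gaussian_logweight_law`: a Gaussian log-weight with `E w = 1`
has mean `−v/2`), `Scaling/GaussianWorkDictionary`, `Scoring/IMHLogNormalAcceptance`.

THE POINT.  `AcceptanceFromMeanEnergyViolation{,Pinsker,Sharp}` and `Phi4HMCFluctuationRelation`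
list the `erfc` law as NOT CLAIMED — rightly: it is a statement about a Gaussian MODEL of the
violation law, while their floors hold for every reversible volume-preserving proposal.  This file
puts the model statement in the same `(X, μ, Ψ, H)` vocabulary with its hypothesis printed.  If the
push-forward of `e^{−H}μ` under `ΔH` is `Z·N(m, v)`, then: Creutz's identity alone pins the variance,
**`v = 2m`** (the converse of the direction typed in the Literature file, which starts from
`N(w/2, w)`); the equilibrium acceptance is **`∫ min(1, e^{−ΔH}) e^{−H} = 2Φ(−√(m/2))·Z`**; and
`2Φ(−√(m/2))` lies in **`[1 − √(m/π), e^{−m/4}]`** (linear tail bound from `φ ≤ 1/√(2π)`; Chernoff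
`Φ(−a) ≤ ½e^{−a²/2}`), consistent with the model-free Pinsker floor
`1 − √(m/2)`.  Also typed, for a Gaussian law NOT constrained by Creutz (every `m`, `v > 0` — what a
proposal without the involution/volume structure would show):
`∫ min(1, e^{−x}) dN(m,v) = N(m,v)(x ≤ 0) + e^{−m+v/2}·N(m − v, v)(x > 0)`.

## What is proved

* §1 (one Gaussian law; `Φ(t) = (gaussianReal 0 1).real (Iic t)`): `gaussianReal_integral_exp_neg`
  (`= e^{−m+v/2}`), **`gaussianReal_integral_exp_neg_eq_one_iff`** (`= 1 ↔ v = 2m`),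
  `gaussianPDFReal_mul_exp_neg` (tilt), **`gaussianReal_integral_min_one_exp_neg`** (every `m`, `v > 0`),
  `gaussianReal_neg_real_Ioi`, **`gaussianReal_integral_min_one_exp_neg_of_var_eq`** (`v = 2m ⇒
  = 2Φ(−√(m/2))`, `m = 0` included), `gaussianReal_std_real_Iic_neg_ge` (`Φ(−a) ≥ ½ − a/√(2π)`),
  `gaussianReal_std_real_Iic_neg_le` (`Φ(−a) ≤ ½e^{−a²/2}`), **`gaussian_acceptance_bounds`**.
* §2 (`Ψ` measurable `μ`-preserving involution, `H` measurable, `0 < Z = ∫ e^{−H}`; hypothesis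
  `hlaw : (e^{−H}μ).map ΔH = Z·N(m, v)`): `integral_comp_deltaH_of_gaussianLaw`,
  **`gaussianLaw_variance_eq_two_mul_mean`**, **`involutive_acceptance_gaussianLaw`**,
  **`involutive_acceptance_gaussianLaw_bounds`** (`(1 − √(m/π))Z ≤ acc ≤ e^{−m/4}Z`).
* §3 row 2's lattice φ⁴ HMC (`λ > 0`, every `J`, `δ`, `N`): **`hmc_acceptance_gaussianLaw`**.

Reading for S0-A and the battery (no numerics implied): an HMC row that models its stored `dH`
series as Gaussian is thereby asserting `var(dH) = 2·mean(dH)` and `acc = erfc(½√mean(dH))`; the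
first is a cheap self-check of the MODEL (exactness does not imply it), the second the model's
prediction to set beside the measured acceptance and the model-free floors.  NOT CLAIMED: that `ΔH`
is Gaussian for any integrator, volume or coupling (it never is exactly); any value for any run;
anything about autocorrelations.
-/

namespace Summit.Ventures.LatticeQCDFlow.Exactness

open Real MeasureTheory ProbabilityTheory Set Filter
open Summit.Ventures.LatticeQCDFlow.Scoring
open scoped NNReal ENNReal

/-! ## §1 Gaussian energy-violation laws: Creutz pins the variance, the acceptance is `2Φ(−√(m/2))` -/

section Gaussian

/-- `∫ e^{−x} dN(m, v)(x) = e^{−m + v/2}` (the moment generating function at `t = −1`). -/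
theorem gaussianReal_integral_exp_neg (m : ℝ) (v : ℝ≥0) :
    ∫ x, Real.exp (-x) ∂(gaussianReal m v) = Real.exp (-m + v / 2) := by
  have h := congrFun (mgf_id_gaussianReal (μ := m) (v := v)) (-1)
  simp only [mgf, id_eq, neg_mul, one_mul] at h
  rw [h]; congr 1; ring

/-- **CREUTZ PINS THE VARIANCE OF A GAUSSIAN VIOLATION LAW**: `∫ e^{−x} dN(m, v) = 1 ↔ v = 2m`. -/
theorem gaussianReal_integral_exp_neg_eq_one_iff (m : ℝ) (v : ℝ≥0) :
    ∫ x, Real.exp (-x) ∂(gaussianReal m v) = 1 ↔ (v : ℝ) = 2 * m := by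
  rw [gaussianReal_integral_exp_neg, Real.exp_eq_one_iff]
  constructor <;> intro h <;> linarith

/-- The exponential tilt of a Gaussian density is a shifted Gaussian density:
`φ_{m,v}(x) e^{−x} = e^{−m + v/2} φ_{m − v, v}(x)`. -/
theorem gaussianPDFReal_mul_exp_neg (m : ℝ) {v : ℝ≥0} (hv : v ≠ 0) (x : ℝ) :
    gaussianPDFReal m v x * Real.exp (-x)
      = Real.exp (-m + v / 2) * gaussianPDFReal (m - v) v x := by
  have hv' : (v : ℝ) ≠ 0 := NNReal.coe_ne_zero.mpr hv
  simp only [gaussianPDFReal]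
  rw [mul_assoc, ← Real.exp_add, mul_left_comm, ← Real.exp_add]
  congr 2
  field_simp
  ring

/-- **THE MEAN OF `min(1, e^{−x})` UNDER A GAUSSIAN**, every mean `m` and variance `v > 0`:
`∫ min(1, e^{−x}) dN(m,v) = N(m,v)(x ≤ 0) + e^{−m + v/2} · N(m − v, v)(x > 0)`. -/
theorem gaussianReal_integral_min_one_exp_neg (m : ℝ) {v : ℝ≥0} (hv : v ≠ 0) :
    ∫ x, min 1 (Real.exp (-x)) ∂(gaussianReal m v)
      = (gaussianReal m v).real (Iic 0)
        + Real.exp (-m + v / 2) * (gaussianReal (m - v) v).real (Ioi 0) := by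
  have hsplit : (fun x : ℝ => min 1 (Real.exp (-x)))
      = fun x => (Iic (0 : ℝ)).indicator 1 x + (Ioi (0 : ℝ)).indicator (fun x => Real.exp (-x)) x := by
    funext x
    by_cases hx : x ≤ 0
    · have h1 : (1 : ℝ) ≤ Real.exp (-x) := by
        rw [← Real.exp_zero]; exact Real.exp_le_exp.mpr (by linarith)
      rw [min_eq_left h1, indicator_of_mem (mem_Iic.mpr hx), indicator_of_notMem (by simpa using hx)]
      simp
    · have hx : 0 < x := not_le.mp hx
      have h1 : Real.exp (-x) ≤ 1 := by
        rw [← Real.exp_zero]; exact Real.exp_le_exp.mpr (by linarith)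
      rw [min_eq_right h1, indicator_of_notMem (by simpa using hx), indicator_of_mem (mem_Ioi.mpr hx)]
      simp
  have hint1 : Integrable (fun x : ℝ => (Iic (0 : ℝ)).indicator (1 : ℝ → ℝ) x) (gaussianReal m v) :=
    (integrable_const (1 : ℝ)).indicator measurableSet_Iic
  have hint2 : Integrable (fun x : ℝ => (Ioi (0 : ℝ)).indicator (fun x => Real.exp (-x)) x)
      (gaussianReal m v) := by
    refine Integrable.mono' (integrable_const (1 : ℝ))
      ((Real.measurable_exp.comp measurable_neg).indicator measurableSet_Ioi).aestronglyMeasurable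
      (Eventually.of_forall fun x => ?_)
    by_cases hx : x ∈ Ioi (0 : ℝ)
    · rw [indicator_of_mem hx, Real.norm_eq_abs, abs_of_nonneg (Real.exp_pos _).le, ← Real.exp_zero]
      exact Real.exp_le_exp.mpr (by simpa using (le_of_lt (mem_Ioi.mp hx)))
    · rw [indicator_of_notMem hx]; simp
  rw [hsplit, integral_add hint1 hint2, integral_indicator_one measurableSet_Iic]
  congr 1
  -- the tilted piece: pass to the density, tilt, and return to a Gaussian measure
  rw [integral_gaussianReal_eq_integral_smul hv]
  have hind : (fun x : ℝ => gaussianPDFReal m v x • (Ioi (0 : ℝ)).indicator (fun x => Real.exp (-x)) x)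
      = fun x => (Ioi (0 : ℝ)).indicator
          (fun x => Real.exp (-m + v / 2) * gaussianPDFReal (m - v) v x) x := by
    funext x
    by_cases hx : x ∈ Ioi (0 : ℝ)
    · rw [indicator_of_mem hx, indicator_of_mem hx, smul_eq_mul, gaussianPDFReal_mul_exp_neg m hv]
    · rw [indicator_of_notMem hx, indicator_of_notMem hx, smul_zero]
  rw [hind, integral_indicator measurableSet_Ioi, integral_const_mul]
  congr 1
  rw [measureReal_def, gaussianReal_apply_eq_integral _ hv, ENNReal.toReal_ofReal
    (setIntegral_nonneg measurableSet_Ioi fun x _ => gaussianPDFReal_nonneg _ _ _)]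

/-- Reflection: `N(−m, v)(x > 0) = N(m, v)(x ≤ 0)` (`v > 0`, no atoms). -/
theorem gaussianReal_neg_real_Ioi (m : ℝ) {v : ℝ≥0} (hv : v ≠ 0) :
    (gaussianReal (-m) v).real (Ioi 0) = (gaussianReal m v).real (Iic 0) := by
  haveI := nullSingletonClass_gaussianReal (μ := m) hv
  rw [← gaussianReal_map_neg, map_measureReal_apply measurable_neg measurableSet_Ioi]
  have hpre : (fun x : ℝ => -x) ⁻¹' Ioi (0 : ℝ) = Iio 0 := by
    ext x; simp
  rw [hpre]
  exact measureReal_congr Iio_ae_eq_Iic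

/-- `Φ(0) = 1/2`. -/
private theorem gaussianReal_std_real_Iic_zero : (gaussianReal (0 : ℝ) 1).real (Iic 0) = 1 / 2 := by
  have h := gaussianReal_neg_real_Ioi (0 : ℝ) (v := 1) one_ne_zero
  rw [neg_zero] at h
  have htot : (gaussianReal (0 : ℝ) 1).real (Iic 0) + (gaussianReal (0 : ℝ) 1).real (Ioi 0) = 1 := by
    rw [← measureReal_union (Set.disjoint_left.mpr fun x hx hx' => (not_lt.mpr (mem_Iic.mp hx))
      (mem_Ioi.mp hx')) measurableSet_Ioi, Iic_union_Ioi, probReal_univ]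
  linarith

/-- **THE GAUSSIAN ACCEPTANCE LAW.**  If the violation law is `N(m, v)` with Creutz's constraint
`v = 2m`, then `∫ min(1, e^{−x}) dN(m, 2m) = 2·Φ(−√(m/2))` (`= erfc(√m/2)`); `m = 0` is the
point mass at `0` (acceptance `1 = 2Φ(0)`). -/
theorem gaussianReal_integral_min_one_exp_neg_of_var_eq (m : ℝ) {v : ℝ≥0} (hv : (v : ℝ) = 2 * m) :
    ∫ x, min 1 (Real.exp (-x)) ∂(gaussianReal m v)
      = 2 * (gaussianReal 0 1).real (Iic (-Real.sqrt (m / 2))) := by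
  have hm0 : 0 ≤ m := by have := v.coe_nonneg; linarith
  rcases hm0.eq_or_lt with hm | hm
  · have hv0 : v = 0 := NNReal.coe_eq_zero.mp (by rw [hv, ← hm]; ring)
    subst hv0
    rw [← hm, gaussianReal_zero_var, integral_dirac, zero_div, Real.sqrt_zero, neg_zero,
      gaussianReal_std_real_Iic_zero]; simp
  · have hvne : v ≠ 0 := by
      intro h; rw [h, NNReal.coe_zero] at hv; linarith
    rw [gaussianReal_integral_min_one_exp_neg m hvne]
    have hexp : Real.exp (-m + v / 2) = 1 := by rw [hv]; simp
    have hmv : m - (v : ℝ) = -m := by rw [hv]; ring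
    rw [hexp, one_mul, hmv, gaussianReal_neg_real_Ioi m hvne, ← two_mul, measureReal_def,
      Literature.Probability.Distributions.PseudoMarginalNoise.gaussianReal_Iic_eq_std m hvne 0,
      ← measureReal_def]
    congr 3
    -- `(0 − m) / √(2m) = −√(m/2)`
    rw [hv, zero_sub, neg_div, neg_inj]
    have h2m : 0 < Real.sqrt (2 * m) := Real.sqrt_pos.mpr (by linarith)
    rw [div_eq_iff h2m.ne', ← Real.sqrt_mul (by linarith : 0 ≤ m / 2),
      show m / 2 * (2 * m) = m ^ 2 by ring, Real.sqrt_sq hm.le]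

/-- The standard normal density is at most `1/√(2π)`. -/
private theorem gaussianPDFReal_std_le_inv_sqrt_two_pi (x : ℝ) :
    gaussianPDFReal 0 1 x ≤ (Real.sqrt (2 * Real.pi))⁻¹ := by
  simp only [gaussianPDFReal, NNReal.coe_one, mul_one, sub_zero]
  refine mul_le_of_le_one_right (inv_nonneg.mpr (Real.sqrt_nonneg _)) ?_
  rw [← Real.exp_zero]; exact Real.exp_le_exp.mpr (by nlinarith [sq_nonneg x])

/-- **Linear lower bound on the Gaussian tail**: `Φ(−a) ≥ 1/2 − a/√(2π)` for `a ≥ 0`. -/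
theorem gaussianReal_std_real_Iic_neg_ge {a : ℝ} (ha : 0 ≤ a) :
    1 / 2 - a / Real.sqrt (2 * Real.pi) ≤ (gaussianReal (0 : ℝ) 1).real (Iic (-a)) := by
  -- `Φ(0) = Φ(−a) + N(0,1)((−a, 0])` and the middle piece is at most `a · sup φ`
  have hsplit : (gaussianReal (0 : ℝ) 1).real (Iic 0)
      = (gaussianReal (0 : ℝ) 1).real (Iic (-a)) + (gaussianReal (0 : ℝ) 1).real (Ioc (-a) 0) := by
    rw [← measureReal_union (Set.disjoint_left.mpr fun x hx hx' => (not_lt.mpr (mem_Iic.mp hx))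
      (mem_Ioc.mp hx').1) measurableSet_Ioc, Iic_union_Ioc_eq_Iic (by linarith)]
  have hmid : (gaussianReal (0 : ℝ) 1).real (Ioc (-a) 0) ≤ a / Real.sqrt (2 * Real.pi) := by
    rw [measureReal_def, gaussianReal_apply_eq_integral _ one_ne_zero, ENNReal.toReal_ofReal
      (setIntegral_nonneg measurableSet_Ioc fun x _ => gaussianPDFReal_nonneg _ _ _)]
    calc ∫ x in Ioc (-a) 0, gaussianPDFReal 0 1 x
        ≤ ∫ x in Ioc (-a) 0, (Real.sqrt (2 * Real.pi))⁻¹ := by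
          refine setIntegral_mono_on (integrable_gaussianPDFReal 0 1).integrableOn
            (integrableOn_const (by simp)) measurableSet_Ioc fun x _ => gaussianPDFReal_std_le_inv_sqrt_two_pi x
      _ = a / Real.sqrt (2 * Real.pi) := by
          rw [setIntegral_const, Real.volume_real_Ioc_of_le (by linarith), smul_eq_mul]
          ring
  rw [gaussianReal_std_real_Iic_zero] at hsplit
  linarith

/-- **Chernoff upper bound on the Gaussian tail**: `Φ(−a) ≤ ½ e^{−a²/2}` for `a ≥ 0`
(pointwise `φ(x) ≤ e^{−a²/2} φ_{−a,1}(x)` on `x ≤ −a`, then the shifted half-mass `1/2`). -/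
theorem gaussianReal_std_real_Iic_neg_le {a : ℝ} (ha : 0 ≤ a) :
    (gaussianReal (0 : ℝ) 1).real (Iic (-a)) ≤ Real.exp (-a ^ 2 / 2) / 2 := by
  have hpt : ∀ x ∈ Iic (-a), gaussianPDFReal 0 1 x ≤ Real.exp (-a ^ 2 / 2) * gaussianPDFReal (-a) 1 x := by
    intro x hx
    have hx' : x ≤ -a := mem_Iic.mp hx
    simp only [gaussianPDFReal, NNReal.coe_one, mul_one, sub_zero, sub_neg_eq_add]
    rw [mul_left_comm, ← Real.exp_add]
    refine mul_le_mul_of_nonneg_left (Real.exp_le_exp.mpr ?_) (inv_nonneg.mpr (Real.sqrt_nonneg _))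
    nlinarith [mul_nonneg ha (by linarith : 0 ≤ -a - x)]
  -- the shifted half-mass: `N(−a, 1)(x ≤ −a) = Φ(0) = 1/2`
  have hhalf : ∫ x in Iic (-a), gaussianPDFReal (-a) 1 x = 1 / 2 := by
    have h := gaussianReal_apply_eq_integral (-a) (v := 1) one_ne_zero (Iic (-a))
    have hreal : (gaussianReal (-a) 1).real (Iic (-a)) = ∫ x in Iic (-a), gaussianPDFReal (-a) 1 x := by
      rw [measureReal_def, h, ENNReal.toReal_ofReal
        (setIntegral_nonneg measurableSet_Iic fun x _ => gaussianPDFReal_nonneg _ _ _)]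
    rw [← hreal, ← gaussianReal_std_real_Iic_zero]
    have hshift : (gaussianReal (0 : ℝ) 1).map (fun x => x + -a) = gaussianReal (-a) 1 := by
      rw [gaussianReal_map_add_const, zero_add]
    rw [← hshift, map_measureReal_apply (f := fun x : ℝ => x + -a) (by fun_prop) measurableSet_Iic]
    congr 1
    ext x; simp
  rw [measureReal_def, gaussianReal_apply_eq_integral _ one_ne_zero, ENNReal.toReal_ofReal
    (setIntegral_nonneg measurableSet_Iic fun x _ => gaussianPDFReal_nonneg _ _ _)]
  calc ∫ x in Iic (-a), gaussianPDFReal 0 1 x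
      ≤ ∫ x in Iic (-a), Real.exp (-a ^ 2 / 2) * gaussianPDFReal (-a) 1 x :=
        setIntegral_mono_on (integrable_gaussianPDFReal 0 1).integrableOn
          ((integrable_gaussianPDFReal (-a) 1).integrableOn.const_mul _) measurableSet_Iic hpt
    _ = Real.exp (-a ^ 2 / 2) / 2 := by rw [integral_const_mul, hhalf]; ring

/-- `2√(m/2)/√(2π) = √(m/π)`. -/
private theorem two_mul_sqrt_half_div_sqrt_two_pi (m : ℝ) :
    2 * Real.sqrt (m / 2) / Real.sqrt (2 * Real.pi) = Real.sqrt (m / Real.pi) := by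
  have h2 : Real.sqrt 2 * Real.sqrt 2 = 2 := Real.mul_self_sqrt zero_le_two
  have hs2 : 0 < Real.sqrt 2 := Real.sqrt_pos.mpr zero_lt_two
  have hspi : 0 < Real.sqrt Real.pi := Real.sqrt_pos.mpr Real.pi_pos
  rw [Real.sqrt_div' m Real.pi_pos.le, Real.sqrt_div' m zero_le_two, Real.sqrt_mul zero_le_two]
  have e : 2 * (Real.sqrt m / Real.sqrt 2) / (Real.sqrt 2 * Real.sqrt Real.pi)
      = (2 / (Real.sqrt 2 * Real.sqrt 2)) * (Real.sqrt m / Real.sqrt Real.pi) := by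
    field_simp
  rw [e, h2, div_self two_ne_zero, one_mul]

/-- **TWO-SIDED ENVELOPE OF THE GAUSSIAN ACCEPTANCE LAW**:
`1 − √(m/π) ≤ 2Φ(−√(m/2)) ≤ e^{−m/4}` for `m ≥ 0`. -/
theorem gaussian_acceptance_bounds {m : ℝ} (hm : 0 ≤ m) :
    1 - Real.sqrt (m / Real.pi) ≤ 2 * (gaussianReal (0 : ℝ) 1).real (Iic (-Real.sqrt (m / 2)))
    ∧ 2 * (gaussianReal (0 : ℝ) 1).real (Iic (-Real.sqrt (m / 2))) ≤ Real.exp (-m / 4) := by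
  have ha : 0 ≤ Real.sqrt (m / 2) := Real.sqrt_nonneg _
  constructor
  · have h := gaussianReal_std_real_Iic_neg_ge ha
    have e := two_mul_sqrt_half_div_sqrt_two_pi m
    rw [mul_div_assoc] at e
    rw [← e]
    linarith
  · have h := gaussianReal_std_real_Iic_neg_le ha
    rw [Real.sq_sqrt (by linarith : 0 ≤ m / 2)] at h
    rw [show -m / 4 = -(m / 2) / 2 by ring]
    linarith

end Gaussian

/-! ## §2 A measure-preserving involution whose equilibrium violation law is Gaussian -/

section Involution

variable {X : Type*} [MeasurableSpace X] {μ : Measure X}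

/-- Transport of integrals along the hypothesis "the law of `ΔH` under `e^{−H}μ` is `Z·N(m, v)`":
for every measurable `g : ℝ → ℝ`, `∫ g(ΔH) e^{−H} dμ = Z ∫ g dN(m, v)`. -/
theorem integral_comp_deltaH_of_gaussianLaw {H : X → ℝ} {Ψ : X → X} (hH : Measurable H)
    (hΨm : Measurable Ψ) {m : ℝ} {v : ℝ≥0}
    (hlaw : (μ.withDensity fun z => ENNReal.ofReal (Real.exp (-H z))).map (deltaH H Ψ)
      = ENNReal.ofReal (∫ z, Real.exp (-H z) ∂μ) • gaussianReal m v)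
    {g : ℝ → ℝ} (hg : Measurable g) :
    ∫ z, g (deltaH H Ψ z) * Real.exp (-H z) ∂μ
      = (∫ z, Real.exp (-H z) ∂μ) * ∫ x, g x ∂(gaussianReal m v) := by
  have hΔ : Measurable (deltaH H Ψ) := measurable_deltaH hH hΨm
  have hdens : Measurable fun z => ENNReal.ofReal (Real.exp (-H z)) :=
    ENNReal.measurable_ofReal.comp (Real.measurable_exp.comp hH.neg)
  have hZ0 : 0 ≤ ∫ z, Real.exp (-H z) ∂μ := integral_nonneg fun z => (Real.exp_pos _).le
  have h1 : ∫ x, g x ∂((μ.withDensity fun z => ENNReal.ofReal (Real.exp (-H z))).map (deltaH H Ψ))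
      = ∫ z, g (deltaH H Ψ z) * Real.exp (-H z) ∂μ := by
    rw [integral_map hΔ.aemeasurable hg.aestronglyMeasurable,
      integral_withDensity_eq_integral_toReal_smul hdens (Eventually.of_forall fun _ =>
        ENNReal.ofReal_lt_top)]
    refine integral_congr_ae (Eventually.of_forall fun z => ?_)
    simp only
    rw [ENNReal.toReal_ofReal (Real.exp_pos _).le, smul_eq_mul, mul_comm]
  rw [← h1, hlaw, integral_smul_measure, ENNReal.toReal_ofReal hZ0, smul_eq_mul]

/-- **CREUTZ PINS THE VARIANCE**: for a measurable `μ`-preserving involution `Ψ` and a measurable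
`H` with `0 < Z = ∫ e^{−H} dμ`, if the equilibrium law of `ΔH = H∘Ψ − H` is `N(m, v)` then
`v = 2m` (in particular `m ≥ 0`). -/
theorem gaussianLaw_variance_eq_two_mul_mean {H : X → ℝ} {Ψ : X → X} (hH : Measurable H)
    (hΨm : Measurable Ψ) (hΨi : Function.Involutive Ψ) (hΨμ : MeasurePreserving Ψ μ μ)
    (hZ : 0 < ∫ z, Real.exp (-H z) ∂μ) {m : ℝ} {v : ℝ≥0}
    (hlaw : (μ.withDensity fun z => ENNReal.ofReal (Real.exp (-H z))).map (deltaH H Ψ)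
      = ENNReal.ofReal (∫ z, Real.exp (-H z) ∂μ) • gaussianReal m v) :
    (v : ℝ) = 2 * m := by
  have hc := creutz_integral (H := H) hΨm hΨi hΨμ
  rw [integral_comp_deltaH_of_gaussianLaw hH hΨm hlaw (g := fun x => Real.exp (-x)) (by fun_prop),
    gaussianReal_integral_exp_neg] at hc
  have h1 : Real.exp (-m + v / 2) = 1 := by
    have := mul_left_cancel₀ hZ.ne' (hc.trans (mul_one _).symm)
    exact this
  rw [Real.exp_eq_one_iff] at h1
  linarith

/-- **THE GAUSSIAN ACCEPTANCE LAW FOR AN INVOLUTIVE (HMC-TYPE) UPDATE.**  Same setting; if the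
equilibrium law of `ΔH` is `N(m, v)` then the equilibrium acceptance is
`∫ min(1, e^{−ΔH}) e^{−H} dμ = 2Φ(−√(m/2)) · Z` (`= erfc(½√m) · Z`). -/
theorem involutive_acceptance_gaussianLaw {H : X → ℝ} {Ψ : X → X} (hH : Measurable H)
    (hΨm : Measurable Ψ) (hΨi : Function.Involutive Ψ) (hΨμ : MeasurePreserving Ψ μ μ)
    (hZ : 0 < ∫ z, Real.exp (-H z) ∂μ) {m : ℝ} {v : ℝ≥0}
    (hlaw : (μ.withDensity fun z => ENNReal.ofReal (Real.exp (-H z))).map (deltaH H Ψ)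
      = ENNReal.ofReal (∫ z, Real.exp (-H z) ∂μ) • gaussianReal m v) :
    ∫ z, min 1 (Real.exp (-deltaH H Ψ z)) * Real.exp (-H z) ∂μ
      = 2 * (gaussianReal (0 : ℝ) 1).real (Iic (-Real.sqrt (m / 2))) * ∫ z, Real.exp (-H z) ∂μ := by
  have hv := gaussianLaw_variance_eq_two_mul_mean hH hΨm hΨi hΨμ hZ hlaw
  rw [integral_comp_deltaH_of_gaussianLaw hH hΨm hlaw (g := fun x => min 1 (Real.exp (-x)))
      (measurable_const.min (by fun_prop)),
    gaussianReal_integral_min_one_exp_neg_of_var_eq m hv, mul_comm]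

/-- **Its two-sided envelope in the mean violation**: `(1 − √(m/π))·Z ≤ acceptance ≤ e^{−m/4}·Z`. -/
theorem involutive_acceptance_gaussianLaw_bounds {H : X → ℝ} {Ψ : X → X} (hH : Measurable H)
    (hΨm : Measurable Ψ) (hΨi : Function.Involutive Ψ) (hΨμ : MeasurePreserving Ψ μ μ)
    (hZ : 0 < ∫ z, Real.exp (-H z) ∂μ) {m : ℝ} {v : ℝ≥0}
    (hlaw : (μ.withDensity fun z => ENNReal.ofReal (Real.exp (-H z))).map (deltaH H Ψ)
      = ENNReal.ofReal (∫ z, Real.exp (-H z) ∂μ) • gaussianReal m v) :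
    (1 - Real.sqrt (m / Real.pi)) * ∫ z, Real.exp (-H z) ∂μ
        ≤ ∫ z, min 1 (Real.exp (-deltaH H Ψ z)) * Real.exp (-H z) ∂μ
      ∧ ∫ z, min 1 (Real.exp (-deltaH H Ψ z)) * Real.exp (-H z) ∂μ
        ≤ Real.exp (-m / 4) * ∫ z, Real.exp (-H z) ∂μ := by
  have hv := gaussianLaw_variance_eq_two_mul_mean hH hΨm hΨi hΨμ hZ hlaw
  have hm : 0 ≤ m := by have := v.coe_nonneg; linarith
  rw [involutive_acceptance_gaussianLaw hH hΨm hΨi hΨμ hZ hlaw]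
  obtain ⟨h1, h2⟩ := gaussian_acceptance_bounds hm
  exact ⟨mul_le_mul_of_nonneg_right h1 hZ.le, mul_le_mul_of_nonneg_right h2 hZ.le⟩

end Involution

/-! ## §3 Row 2's lattice φ⁴ HMC -/

section Lattice

variable {n : ℕ}

/-- **THE `erfc` LAW AS A THEOREM, row 2's HMC** (`λ > 0`, every real `J`, every step `δ` and
trajectory length `N`): IF the equilibrium law of the energy violation `ΔH` of one trajectory is
Gaussian, `N(m, v)`, THEN `v = 2m` and the equilibrium acceptance is `2Φ(−√(m/2))·Z = erfc(½√m)·Z`,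
inside the envelope `[(1 − √(m/π))Z, e^{−m/4}Z]`. -/
theorem hmc_acceptance_gaussianLaw {lam : ℝ} (hlam : 0 < lam) (J : Fin (n + 1) → Fin (n + 1) → ℝ)
    (δ : ℝ) (N : ℕ) {m : ℝ} {v : ℝ≥0}
    (hlaw : ((((volume : Measure (Fin (n + 1) → ℝ)).prod volume).withDensity
        fun z => ENNReal.ofReal (Real.exp (-phi4HmcEnergy J lam z))).map (hmcDeltaH J lam δ N))
      = ENNReal.ofReal (∫ z, Real.exp (-phi4HmcEnergy J lam z)
          ∂((volume : Measure (Fin (n + 1) → ℝ)).prod volume)) • gaussianReal m v) :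
    (v : ℝ) = 2 * m
    ∧ ∫ z, min 1 (Real.exp (-hmcDeltaH J lam δ N z)) * Real.exp (-phi4HmcEnergy J lam z)
        ∂((volume : Measure (Fin (n + 1) → ℝ)).prod volume)
      = 2 * (gaussianReal (0 : ℝ) 1).real (Iic (-Real.sqrt (m / 2)))
        * ∫ z, Real.exp (-phi4HmcEnergy J lam z) ∂((volume : Measure (Fin (n + 1) → ℝ)).prod volume)
    ∧ (1 - Real.sqrt (m / Real.pi))
        * ∫ z, Real.exp (-phi4HmcEnergy J lam z) ∂((volume : Measure (Fin (n + 1) → ℝ)).prod volume)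
      ≤ ∫ z, min 1 (Real.exp (-hmcDeltaH J lam δ N z)) * Real.exp (-phi4HmcEnergy J lam z)
        ∂((volume : Measure (Fin (n + 1) → ℝ)).prod volume)
    ∧ ∫ z, min 1 (Real.exp (-hmcDeltaH J lam δ N z)) * Real.exp (-phi4HmcEnergy J lam z)
        ∂((volume : Measure (Fin (n + 1) → ℝ)).prod volume)
      ≤ Real.exp (-m / 4)
        * ∫ z, Real.exp (-phi4HmcEnergy J lam z) ∂((volume : Measure (Fin (n + 1) → ℝ)).prod volume) := by
  have hZ : 0 < ∫ z, Real.exp (-phi4HmcEnergy J lam z)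
      ∂((volume : Measure (Fin (n + 1) → ℝ)).prod volume) :=
    integral_exp_pos (integrable_exp_neg_phi4HmcEnergy one_pos (latticePhi4Action_coercive hlam J))
  have hH := measurable_phi4HmcEnergy J lam
  have hΨm := measurable_hmcProposal J lam δ N
  have hΨi := hmcProposal_involutive J lam δ N
  have hΨμ := measurePreserving_hmcProposal J lam δ N
  refine ⟨gaussianLaw_variance_eq_two_mul_mean hH hΨm hΨi hΨμ hZ hlaw,
    involutive_acceptance_gaussianLaw hH hΨm hΨi hΨμ hZ hlaw, ?_⟩
  exact involutive_acceptance_gaussianLaw_bounds hH hΨm hΨi hΨμ hZ hlaw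

end Lattice

end Summit.Ventures.LatticeQCDFlow.Exactness
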